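import Summits.QuantumFields.YangMills.Theorems.UnitScaleTiltProp7PinnedFlatCoercivity
import HarnessLib

/-!
# Route `UnitScaleTilt`, crux K1 «MinimiserStabilityRegPr» (stmt-QuantumFields-19200), route-R E′ path (α′) (✓ `…LocMinOfPinnedChartSlice`, inhabitant of record ★p1 g14
# 17:02Z) — LEMMA (S_H-SUP′), FLAT BOOKKEEPING: the pinned re-gauging of a chart `A` to the centre-harmonic slice `S_H` is the gradient of the INTERPOLATION ERROR of
# its longitudinal potential; its sup cost is displayed as ONE scale-ℓ-local interpolation bound, and the curl is untouched

Cell `ym3-torus`, D-0154 (3c) twin-width seat `ym-routeR-w3` (gen 5); ★p1 g14 17:02:03Z «routeR-w3: S_H-SUP′-flat — GO, YOUR PEN (§1 ψ-algebra as the interpolation error of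
the longitudinal potential; §2 sup assembly with `hInterp` displayed; §3 instantiation under (1.36)-shaped rows)».  THEOREMS ONLY (0 `def`, 0 `sorry`);
`--supports stmt-QuantumFields-19200`, count-neutral.  YM₃ on T³ is a ladder rung (R3), not the Clay problem; nothing here claims the stub, the crux, d = 4 or the gap.

THE POINT (★p1 g14 LOCATE 17:03:43Z (S1)–(S4), ★routeR-w3 g5 16:51∕16:56Z).  Given a chart direction `A` (a `V`-valued bond field on `T^{(j)}`), a longitudinal potential `φ`
(`Δφ = ∂^*A`) and ANY site function `φ_H` agreeing with `φ` on the centre set `C`, the pinned gauge function `ψ = φ − φ_H` (`ψ|_C = 0`) re-gauges `A` to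
`A_H = A − ∂ψ` with `∂^*A_H = Δφ_H` and `curl A_H = curl A`; if `φ_H` is the pinned BIHARMONIC interpolant (`Δ²φ_H = 0` off `C`) then `A_H` lies on the centre-harmonic
slice `S_H = {Δ∂^*A_H = 0 off C}`, and `sup‖A_H‖ ≤ sup‖A‖ + sup‖∂(φ − φ_H)‖` — the second term is the `W^{1,∞}` INTERPOLATION ERROR of `φ`, a scale-ℓ-LOCAL quantity,
displayed here as ONE hypothesis `hInterp : ‖∂(φ − φ_H)(b)‖ ≤ c_I·ℓ·s₁` against a sup bound `s₁` of `Δφ = ∂^*A`.  Under print's (1.36)-shaped rows `‖A(b)‖ ≤ s₀ℓ⁻¹`,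
`‖∂^*A(x)‖ ≤ s₁′ℓ⁻²` this gives `‖A_H(b)‖ ≤ (s₀ + c_I s₁′)·ℓ⁻¹` — k- and volume-uniform as soon as `c_I` is (★p1's (α′) of record; the naive bound against `sup‖A‖` alone
carries `(2∕π)log ℓ`, ★routeR-w3 16:51Z ∕ ★p1 16:50Z).

WHAT IS PROVED (ns `…Theorems.Prop7CentreHarmonicRegaugeSup`; any `P`, level `j`, normed real `V`; `LatticeFieldCalculus` letters `grad`, `diverg`, `laplace`, `curl`, `gaugeShift`,
lattice factor `c`).
* §1 `diverg_regauge`, `curl_regauge`, `regauge_vanishes_on`, `laplace_diverg_regauge_eq_zero_off` (S_H membership from the biharmonic Euler–Lagrange property of `φ_H`),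
  `norm_regauge_le` (`‖A_H b‖ ≤ ‖A b‖ + ‖∂(φ − φ_H) b‖`).
* §2 ★★ `sup_regauge_le_of_interp` — with `hInterp` displayed: `‖A_H b‖ ≤ s_A + c_I·ℓ·s₁`.
* §3 ★★★ `sup_regauge_le_of_rows` — under `‖A b‖ ≤ s₀ℓ⁻¹`, `‖∂^*A x‖ ≤ s₁′(ℓ²)⁻¹` (the (1.36)₁∕(1.36)₂-shaped rows; `ℓ > 0`): `‖A_H b‖ ≤ (s₀ + c_I·s₁′)·ℓ⁻¹`, together with
  `curl A_H = curl A` and the `S_H` membership.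
HONEST SCOPE.  Pure bookkeeping; the two analytic inputs stay DISPLAYED: (E) a longitudinal potential `φ` with `Δφ = ∂^*A` and a pinned biharmonic interpolant `φ_H` of `φ|_C`
(finite-dimensional linear algebra on the torus; `∂^*A ⊥ 1`), (I) the interpolation bound `hInterp` with an L-only `c_I` (the `W^{1,∞}` error of pinned biharmonic interpolation at
scale ℓ against `sup|Δφ|` — the screened biharmonic Green's gradient, `Σ_z|∇_xΔ_zG_C^{(2)}(x,z)| ≲ ℓ` in d = 3; NOT proved here).  Flat letters only; the curved twin (`D_W`, `Δ_W`)
is not touched.  Constants ours; nothing of [Balaban1984PropagatorsI] beyond the cited tree letters is asserted.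

References: T. Bałaban, CMP 95 (1984) 17–40 [Balaban1984PropagatorsI] ((1.2)–(1.4) p.18, (1.21) p.21); CMP 96 (1984) 223–250 [Balaban1984PropagatorsII] ((2.8) p.224);
CMP 99 (1985) 75–102 [Balaban1985RegularSpaces] ((1.14) p.78, (1.36) p.82); CMP 102 (1985) 277–309 [Balaban1985Variational] (Prop. 7 p.299).
-/

set_option autoImplicit false

noncomputable section

open scoped BigOperators

namespace Summit.QuantumFields.YangMills.Theorems.Prop7CentreHarmonicRegaugeSup

open Literature.MathematicalPhysics.QuantumFieldTheory.Balaban1983to89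
open Finset LatticeFieldCalculus

variable {P : Params} {j : ℕ} {V : Type*} [NormedAddCommGroup V] [NormedSpace ℝ V]

/-! ## §1 The pinned re-gauging to `S_H`: algebra -/

/-- **`∂^*A_H = Δφ_H`** for `A_H = A − ∂(φ − φ_H)` and `Δφ = ∂^*A` (✓ `diverg_gaugeShift`, linearity of `Δ`). [cite: Balaban1984PropagatorsII, (2.8) p.224] -/
theorem diverg_regauge (c : ℝ) (A : VecField P j V) (φ φH : SiteField P j V) (hφ : laplace c φ = diverg c A) :
    diverg c (gaugeShift c (fun x => φ x - φH x) A) = laplace c φH := by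
  rw [diverg_gaugeShift]
  funext x
  have hx := congrFun hφ x
  simp only [laplace] at hx ⊢
  rw [← hx, ← Finset.sum_sub_distrib]
  refine Finset.sum_congr rfl fun μ _ => ?_
  module

/-- **`curl A_H = curl A`** (a gradient has no curl, ✓ `curl_gaugeShift`). [cite: Balaban1984PropagatorsI, (1.2) p.18] -/
theorem curl_regauge (c : ℝ) (A : VecField P j V) (ψ : SiteField P j V) (p : Plaq P j) :
    curl c (gaugeShift c ψ A) p = curl c A p :=
  curl_gaugeShift c c ψ A p

omit [NormedSpace ℝ V] in
/-- the gauge function `ψ = φ − φ_H` VANISHES on the centre set (`ψ↓ = 0`: the re-gauging stays inside the pinned group (1.14)). [cite: Balaban1985RegularSpaces, (1.14) p.78] -/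
theorem regauge_vanishes_on (C : Set (Site P j)) (φ φH : SiteField P j V) (hH : ∀ x ∈ C, φH x = φ x) :
    ∀ x ∈ C, (fun x => φ x - φH x) x = 0 := fun x hx => by simp [hH x hx]

/-- **`S_H` MEMBERSHIP**: if `φ_H` is biharmonic off the centres (`Δ²φ_H = 0` off `C` — the Euler–Lagrange property of the pinned `‖Δ·‖²`-minimal interpolant), then
`Δ(∂^*A_H) = 0` off `C`. [cite: Balaban1985Variational, Prop. 7 p.299] -/
theorem laplace_diverg_regauge_eq_zero_off (c : ℝ) (C : Set (Site P j)) (A : VecField P j V) (φ φH : SiteField P j V) (hφ : laplace c φ = diverg c A)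
    (hEL : ∀ x ∉ C, laplace c (laplace c φH) x = 0) :
    ∀ x ∉ C, laplace c (diverg c (gaugeShift c (fun x => φ x - φH x) A)) x = 0 := by
  intro x hx
  rw [diverg_regauge c A φ φH hφ]
  exact hEL x hx

/-- `‖A_H(b)‖ ≤ ‖A(b)‖ + ‖∂(φ − φ_H)(b)‖`. [folklore] -/
theorem norm_regauge_le (c : ℝ) (A : VecField P j V) (ψ : SiteField P j V) (b : PBond P j) :
    ‖gaugeShift c ψ A b‖ ≤ ‖A b‖ + ‖grad c ψ b‖ := by
  show ‖A b - grad c ψ b‖ ≤ _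
  exact norm_sub_le _ _

/-! ## §2 ★★ The sup assembly with the interpolation bound displayed -/

/-- ★★ **(S_H-SUP′) WITH `hInterp` DISPLAYED**: for a sup bound `s_A` of `A`, a sup bound `s₁` of `Δφ = ∂^*A`, and the scale-ℓ `W^{1,∞}` interpolation bound
`‖∂(φ − φ_H)(b)‖ ≤ c_I·ℓ·s₁`:  `‖A_H(b)‖ ≤ s_A + c_I·ℓ·s₁` at every bond. [cite: Balaban1984PropagatorsI, (1.4) p.18; Balaban1985RegularSpaces, (1.36) p.82] -/
theorem sup_regauge_le_of_interp (c : ℝ) (A : VecField P j V) (φ φH : SiteField P j V) {sA s₁ cI ℓ : ℝ}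
    (hA : ∀ b, ‖A b‖ ≤ sA)
    (hInterp : ∀ b, ‖grad c (fun x => φ x - φH x) b‖ ≤ cI * ℓ * s₁) :
    ∀ b, ‖gaugeShift c (fun x => φ x - φH x) A b‖ ≤ sA + cI * ℓ * s₁ :=
  fun b => (norm_regauge_le c A _ b).trans (add_le_add (hA b) (hInterp b))

/-! ## §3 ★★★ Instantiation under the (1.36)-shaped rows -/

/-- ★★★ **LEMMA (S_H-SUP′), FLAT, UNDER PRINT'S ROWS**: `ℓ > 0`; chart row `‖A(b)‖ ≤ s₀ℓ⁻¹` ((1.36)₁); `s₁′(ℓ²)⁻¹` = a sup bound of `∂^*A = Δφ` (from (1.36)₂ `|∇A| ≲ ℓ⁻²`) entering ONLY through `hInterp`; a longitudinal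
potential `φ` (`Δφ = ∂^*A`) and a pinned interpolant `φ_H` of `φ|_C`, biharmonic off `C`, with the interpolation bound `‖∂(φ − φ_H)(b)‖ ≤ c_I·ℓ·(s₁′(ℓ²)⁻¹)`.  Then the
re-gauged `A_H = A − ∂(φ − φ_H)`: (i) `‖A_H(b)‖ ≤ (s₀ + c_I·s₁′)·ℓ⁻¹` at every bond, (ii) `curl A_H = curl A`, (iii) `Δ(∂^*A_H) = 0` off `C` (`A_H ∈ S_H`), (iv) the gauge function vanishes on `C`.
[cite: Balaban1985RegularSpaces, (1.36) p.82, (1.14) p.78; Balaban1985Variational, Prop. 7 p.299] -/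
theorem sup_regauge_le_of_rows (c : ℝ) (C : Set (Site P j)) (A : VecField P j V) (φ φH : SiteField P j V) {s₀ s₁' cI ℓ : ℝ} (hℓ : 0 < ℓ)
    (hA : ∀ b, ‖A b‖ ≤ s₀ * ℓ⁻¹)
    (hφ : laplace c φ = diverg c A) (hH : ∀ x ∈ C, φH x = φ x) (hEL : ∀ x ∉ C, laplace c (laplace c φH) x = 0)
    (hInterp : ∀ b, ‖grad c (fun x => φ x - φH x) b‖ ≤ cI * ℓ * (s₁' * (ℓ ^ 2)⁻¹)) :
    (∀ b, ‖gaugeShift c (fun x => φ x - φH x) A b‖ ≤ (s₀ + cI * s₁') * ℓ⁻¹)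
      ∧ (∀ p, curl c (gaugeShift c (fun x => φ x - φH x) A) p = curl c A p)
      ∧ (∀ x ∉ C, laplace c (diverg c (gaugeShift c (fun x => φ x - φH x) A)) x = 0)
      ∧ (∀ x ∈ C, (fun x => φ x - φH x) x = 0) := by
  refine ⟨fun b => ?_, fun p => curl_regauge c A _ p, laplace_diverg_regauge_eq_zero_off c C A φ φH hφ hEL, regauge_vanishes_on C φ φH hH⟩
  have h := sup_regauge_le_of_interp c A φ φH hA hInterp b
  have e : s₀ * ℓ⁻¹ + cI * ℓ * (s₁' * (ℓ ^ 2)⁻¹) = (s₀ + cI * s₁') * ℓ⁻¹ := by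
    field_simp
  rw [← e]
  exact h

end Summit.QuantumFields.YangMills.Theorems.Prop7CentreHarmonicRegaugeSup
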